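import Mathlib.Analysis.SpecialFunctions.Pow.Real
import Mathlib.Analysis.SpecialFunctions.Log.Basic
import Mathlib.Analysis.SpecialFunctions.Sqrt
import Mathlib.Analysis.Complex.Basic
import Mathlib.Algebra.Order.Chebyshev
import HarnessLib

/-!
# `IntegerScrew.ScrewPolyFloor`, line `weil-comb-floor` — stub S5 `stub_shadowBudget`

Crux `ScrewPolyFloor` (stmt-RiemannHypothesis-15757) of route IntegerScrew, line `weil-comb-floor`
(skeleton `Cruxes/ScrewPolyFloor/Lines/weil_comb_floor.lean`).  WeilComb's analytic reduction of
the Weil form of a log-integer comb (`WeilCombSubcritical.analyticReduction`) carries an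
archimedean "shadow"
`5 A₋ A₊ + 2 B + 2 A₁²`, `A₋ = Σ_{m ≤ M} |y_m|/√m`, `A₊ = Σ |y_m| √m`,
`B = Σ_{m ≠ m'} |y_m||y_m'|/|log m − log m'|`, `A₁ = Σ |y_m|`,
and the line needs it to be polynomially bounded by `‖y‖² = Σ |y_m|²`.  This file proves
`shadow ≤ 12 M² ‖y‖²` (in fact `≤ 9 M² ‖y‖²`) by Cauchy–Schwarz `A₁² ≤ M ‖y‖²`
(`sq_sum_le_card_mul_sum_sq`), `1/√m ≤ 1`, `√m ≤ M`, and the spacing of the logarithms of the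
integers up to `M`: `|log m − log m'| ≥ 1/M` for `m ≠ m'` in `{1, …, M}`.

Elementary; Mathlib only.  The coefficients appear as `‖((y m : ℝ) : ℂ)‖` because that is the
shape in which the reduction is instantiated (`a m := (y m : ℂ)`).
-/

-- the layout-mandated namespace `Summit.RiemannHypothesis.RiemannHypothesis.…` repeats the summit name
set_option linter.dupNamespace false

namespace Summit.RiemannHypothesis.RiemannHypothesis.Theorems.IntegerScrewScrewPolyFloor

open Finset

/-- Spacing of `log` on the integers up to `M`: for `m ≠ m'` in `{1, …, M}`,
`1/M ≤ |log m − log m'|` (from `log (k+1) − log k ≥ 1/(k+1)`, `k + 1 ≤ M`). -/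
theorem inv_le_abs_log_sub_log {M m m' : ℕ} (hm : m ∈ Icc 1 M) (hm' : m' ∈ Icc 1 M)
    (hne : m ≠ m') : 1 / (M : ℝ) ≤ |Real.log m - Real.log m'| := by
  -- reduce to `m' < m`
  wlog hlt : m' < m generalizing m m'
  · have h := this hm' hm (Ne.symm hne) (lt_of_le_of_ne (not_lt.1 hlt) hne)
    rwa [abs_sub_comm] at h
  rw [Finset.mem_Icc] at hm hm'
  have hk0 : (0 : ℝ) < m' := by exact_mod_cast hm'.1
  have hk1 : (m' : ℝ) + 1 ≤ m := by exact_mod_cast hlt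
  have hM : (m' : ℝ) + 1 ≤ M := by exact_mod_cast (show m' + 1 ≤ M by omega)
  have hm0 : (0 : ℝ) < m := by linarith
  -- `log m - log m' ≥ log (m'+1) - log m' ≥ 1/(m'+1) ≥ 1/M`
  have h1 : 1 / ((m' : ℝ) + 1) ≤ Real.log ((m' : ℝ) + 1) - Real.log m' := by
    have h := Real.log_le_sub_one_of_pos (show (0 : ℝ) < m' / (m' + 1) by positivity)
    rw [Real.log_div hk0.ne' (by linarith)] at h
    have e : (m' : ℝ) / (m' + 1) - 1 = -(1 / (m' + 1)) := by
      field_simp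
      ring
    rw [e] at h
    linarith
  have h2 : Real.log ((m' : ℝ) + 1) ≤ Real.log m := Real.log_le_log (by linarith) hk1
  have h3 : 1 / (M : ℝ) ≤ 1 / ((m' : ℝ) + 1) :=
    one_div_le_one_div_of_le (by linarith) hM
  have h4 : 0 < 1 / ((m' : ℝ) + 1) := by positivity
  rw [abs_of_nonneg (by linarith)]
  linarith

/-- **Stub S5 `stub_shadowBudget` of line `weil-comb-floor`**: the archimedean shadow of the
analytic reduction, read on real coefficients `y`, is at most `12 M² Σ_{m ≤ M} |y_m|²`:
`5 A₋A₊ ≤ 5 M A₁²`, `2B ≤ 2 M A₁²`, `2 A₁² ≤ 2 A₁²` and `A₁² ≤ M ‖y‖²` (Cauchy–Schwarz). -/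
theorem stub_shadowBudget : ∀ (M : ℕ) (y : ℕ → ℝ), 1 ≤ M →
    5 * (∑ m ∈ Finset.Icc 1 M, ‖((y m : ℝ) : ℂ)‖ / Real.sqrt m) *
        (∑ m ∈ Finset.Icc 1 M, ‖((y m : ℝ) : ℂ)‖ * Real.sqrt m) +
      2 * (∑ m ∈ Finset.Icc 1 M, ∑ m' ∈ (Finset.Icc 1 M).erase m,
        ‖((y m : ℝ) : ℂ)‖ * ‖((y m' : ℝ) : ℂ)‖ / |Real.log m - Real.log m'|) +
      2 * (∑ m ∈ Finset.Icc 1 M, ‖((y m : ℝ) : ℂ)‖) ^ 2 ≤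
    12 * (M : ℝ) ^ 2 * ∑ m ∈ Finset.Icc 1 M, ‖((y m : ℝ) : ℂ)‖ ^ 2 := by
  intro M y hM
  set a : ℕ → ℝ := fun m => ‖((y m : ℝ) : ℂ)‖ with ha_def
  have ha0 : ∀ m, 0 ≤ a m := fun m => norm_nonneg _
  set A1 : ℝ := ∑ m ∈ Finset.Icc 1 M, a m with hA1
  set L : ℝ := ∑ m ∈ Finset.Icc 1 M, a m ^ 2 with hL
  have hMr : (1 : ℝ) ≤ M := by exact_mod_cast hM
  have hM0 : (0 : ℝ) < M := by linarith
  have hA10 : 0 ≤ A1 := Finset.sum_nonneg fun m _ => ha0 m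
  have hL0 : 0 ≤ L := Finset.sum_nonneg fun m _ => sq_nonneg _
  -- Cauchy–Schwarz: `A₁² ≤ M L`
  have hCS : A1 ^ 2 ≤ M * L := by
    have h := sq_sum_le_card_mul_sum_sq (s := Finset.Icc 1 M) (f := a)
    simpa [Nat.card_Icc] using h
  -- `A₋ ≤ A₁`
  have hAm : ∑ m ∈ Finset.Icc 1 M, a m / Real.sqrt m ≤ A1 := by
    refine Finset.sum_le_sum fun m hm => ?_
    rw [Finset.mem_Icc] at hm
    have h1 : (1 : ℝ) ≤ Real.sqrt m := by
      rw [Real.one_le_sqrt]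
      exact_mod_cast hm.1
    exact div_le_self (ha0 m) h1
  -- `A₊ ≤ M A₁`
  have hAp : ∑ m ∈ Finset.Icc 1 M, a m * Real.sqrt m ≤ M * A1 := by
    rw [hA1, Finset.mul_sum]
    refine Finset.sum_le_sum fun m hm => ?_
    rw [Finset.mem_Icc] at hm
    have hmM : (m : ℝ) ≤ M := by exact_mod_cast hm.2
    have hsq : Real.sqrt m ≤ M := by
      rw [Real.sqrt_le_left hM0.le]
      nlinarith
    calc a m * Real.sqrt m ≤ a m * M := mul_le_mul_of_nonneg_left hsq (ha0 m)
      _ = M * a m := mul_comm _ _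
  -- the log-Hilbert sum: `B ≤ M A₁²`
  have hB : ∑ m ∈ Finset.Icc 1 M, ∑ m' ∈ (Finset.Icc 1 M).erase m,
      a m * a m' / |Real.log m - Real.log m'| ≤ M * A1 ^ 2 := by
    have hterm : ∀ m ∈ Finset.Icc 1 M, ∀ m' ∈ (Finset.Icc 1 M).erase m,
        a m * a m' / |Real.log m - Real.log m'| ≤ M * (a m * a m') := by
      intro m hm m' hm'
      obtain ⟨hne, hm'⟩ := Finset.mem_erase.1 hm'
      have hsp := inv_le_abs_log_sub_log hm hm' (Ne.symm hne)
      have hpos : 0 < |Real.log m - Real.log m'| := lt_of_lt_of_le (by positivity) hsp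
      rw [div_le_iff₀ hpos]
      calc a m * a m' = M * (a m * a m') * (1 / M) := by field_simp
        _ ≤ M * (a m * a m') * |Real.log m - Real.log m'| :=
            mul_le_mul_of_nonneg_left hsp (by positivity)
    calc ∑ m ∈ Finset.Icc 1 M, ∑ m' ∈ (Finset.Icc 1 M).erase m,
          a m * a m' / |Real.log m - Real.log m'|
        ≤ ∑ m ∈ Finset.Icc 1 M, ∑ m' ∈ (Finset.Icc 1 M).erase m, M * (a m * a m') :=
          Finset.sum_le_sum fun m hm => Finset.sum_le_sum fun m' hm' => hterm m hm m' hm'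
      _ ≤ ∑ m ∈ Finset.Icc 1 M, ∑ m' ∈ Finset.Icc 1 M, M * (a m * a m') :=
          Finset.sum_le_sum fun m _ =>
            Finset.sum_le_sum_of_subset_of_nonneg (Finset.erase_subset _ _)
              fun m' _ _ => by positivity
      _ = M * A1 ^ 2 := by
          rw [hA1, sq, Finset.sum_mul_sum, Finset.mul_sum]
          refine Finset.sum_congr rfl fun m _ => ?_
          rw [Finset.mul_sum]
  -- assemble
  have h5 : 5 * (∑ m ∈ Finset.Icc 1 M, a m / Real.sqrt m) *
      (∑ m ∈ Finset.Icc 1 M, a m * Real.sqrt m) ≤ 5 * (M * A1 ^ 2) := by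
    have hAm0 : 0 ≤ ∑ m ∈ Finset.Icc 1 M, a m / Real.sqrt m :=
      Finset.sum_nonneg fun m _ => div_nonneg (ha0 m) (Real.sqrt_nonneg _)
    calc 5 * (∑ m ∈ Finset.Icc 1 M, a m / Real.sqrt m) *
          (∑ m ∈ Finset.Icc 1 M, a m * Real.sqrt m)
        ≤ 5 * A1 * (M * A1) := by
          apply mul_le_mul (mul_le_mul_of_nonneg_left hAm (by norm_num)) hAp
            (Finset.sum_nonneg fun m _ => mul_nonneg (ha0 m) (Real.sqrt_nonneg _))
            (by positivity)
      _ = 5 * (M * A1 ^ 2) := by ring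
  have hMA : M * A1 ^ 2 ≤ (M : ℝ) ^ 2 * L := by
    calc (M : ℝ) * A1 ^ 2 ≤ M * (M * L) := mul_le_mul_of_nonneg_left hCS hM0.le
      _ = (M : ℝ) ^ 2 * L := by ring
  have hA2 : A1 ^ 2 ≤ (M : ℝ) ^ 2 * L := le_trans (by nlinarith) hMA
  show 5 * (∑ m ∈ Finset.Icc 1 M, a m / Real.sqrt m) *
        (∑ m ∈ Finset.Icc 1 M, a m * Real.sqrt m) +
      2 * (∑ m ∈ Finset.Icc 1 M, ∑ m' ∈ (Finset.Icc 1 M).erase m,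
        a m * a m' / |Real.log m - Real.log m'|) +
      2 * A1 ^ 2 ≤ 12 * (M : ℝ) ^ 2 * L
  nlinarith [h5, hB, hMA, hA2, hL0]

end Summit.RiemannHypothesis.RiemannHypothesis.Theorems.IntegerScrewScrewPolyFloor
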